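import Literature.Analysis.FluidPDE.CylindricalIntegration
import Literature.Analysis.FunctionSpaces.TorusLadyzhenskaya
import HarnessLib

/-!
# Ladyzhenskaya's inequality for axially symmetric functions supported off the axis

Analysis/FluidPDE support file (everything proved; no named facts) on the decomposition path of
the named fact `SereginZajaczkowski2007.OffAxisPoloidalBound` (G. Seregin, W. Zajaczkowski,
SIAM J. Math. Anal. 39 (2007) 669–685 = arXiv:math/0702720, Lemma 4.2). The proof of that lemma
"exploit[s the] two-dimensional feature of our axially symmetric problem in the following way.
So, by Ladyzhenskaya's inequality,
`∫_𝒞̃ |V_φ|⁴ dx ≤ c ∫_{-2}^{2} ∫_{1/4}^{3} |V_φ|⁴ dϱ dx₃ ≤ c ∫∫ |V_φ|² dϱ dx₃ ∫∫ (|V_φ|² + |∇_a V_φ|²) dϱ dx₃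
≤ c ∫_𝒞̃ |V|² dx ∫_𝒞̃ (|V|² + |∇V|²) dx`" (arXiv p. 5, the display before (4.10); used twice
more before (4.12)): on a shell `{ϱ₀ ≤ ϱ ≤ ϱ₁}`, `ϱ = |x'|`, `ϱ₀ > 0`, Lebesgue measure
`dx = ϱ dϱ dφ dx₃` is comparable with `dϱ dφ dx₃`, so the TWO-dimensional Ladyzhenskaya inequality
`‖g‖⁴_{L⁴(ℝ²)} ≤ c ‖g‖²_{L²(ℝ²)} ‖∇g‖²_{L²(ℝ²)}` applied to the meridian profile `g(ϱ, x₃)` of an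
axially symmetric scalar `f` gives the same inequality for `f` on `ℝ³`, with a constant depending
only on `ϱ₀, ϱ₁`.

## Main statement

`exists_axisym_ladyzhenskaya_const`: for `0 < ϱ₀ ≤ ϱ₁` there is `C ≥ 0` such that for every
`C¹` compactly supported axially symmetric scalar `f : ℝ³ → ℝ` vanishing outside
`{ϱ₀ ≤ ϱ ≤ ϱ₁}`,
`∫ f⁴ dx ≤ C (∫ f² dx) (∫ ‖Df‖² dx)`.
This is the homogeneous (compact support) form; it is the form in which the estimate is consumed
once the cut-off functions of the proof of Lemma 4.2 are in place.

## Proof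

Let `g = f ∘ meridianPoint : ℝ × ℝ → ℝ`, `g(ϱ, z) = f(ϱ, 0, z)`, the meridian profile (accepted
`MeridianReduction`); it is `C¹`, compactly supported, and even in `ϱ` (`(−ϱ, 0, z) = R_π (ϱ, 0, z)`).
By the radial reduction for axisymmetric scalars (accepted
`IsAxisymmetricScalar.integral_eq`, `dx = ϱ dϱ dφ dz`), for each of `X = f⁴, f², ‖Df‖²`,
`∫ X ϱ⁻¹ dx = c₂ ∫ dz ∫₀^∞ X(ϱ, 0, z) dϱ = (c₂/2) ∫_{ℝ×ℝ} X ∘ meridianPoint`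
(`integral_mul_inv_cylRadius_eq`); on the support `ϱ₀ ≤ ϱ ≤ ϱ₁`, so
`∫ f⁴ ≤ ϱ₁ ∫ f⁴ ϱ⁻¹`, `ϱ₀ ∫ f² ϱ⁻¹ ≤ ∫ f²`, `ϱ₀ ∫ ‖Df‖² ϱ⁻¹ ≤ ∫ ‖Df‖²`; and
`‖Dg(ϱ, z)‖ ≤ 2 ‖Df(ϱ, 0, z)‖` (chain rule, `meridianPoint (ϱ, z) = ϱ e₀ + z e₂`). The planar
inequality is the accepted `FunctionSpaces.lintegral_enorm_pow_four_le` (Ladyzhenskaya 1959,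
from Mathlib's Gagliardo–Nirenberg–Sobolev inequality) on `E = ℝ × ℝ`.

## References

* G. Seregin, W. Zajaczkowski, SIAM J. Math. Anal. 39 (2007) 669–685, arXiv:math/0702720, proof
  of Lemma 4.2, displays before (4.10) and (4.12). [`SereginZajaczkowski2007`]
* O. A. Ladyzhenskaya, Comm. Pure Appl. Math. 12 (1959) 427–433, Lemma 1 (the planar inequality;
  in the tree through [`FoiasManleyRosaTemam2001`, App. II.A (A.47)]).
-/

noncomputable section

open MeasureTheory Set Function Filter Topology TopologicalSpace WithLp Metric
open scoped RealInnerProductSpace ENNReal NNReal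

namespace Literature.Analysis.FluidPDE

/-! ### The meridian embedding `(ϱ, z) ↦ (ϱ, 0, z)` as a linear map -/

/-- `meridianPoint (ϱ, z) = ϱ e₀ + z e₂`. [folklore] -/
theorem meridianPoint_eq_smul_add_smul (q : ℝ × ℝ) :
    meridianPoint q = q.1 • EuclideanSpace.single (0 : Fin 3) (1 : ℝ) +
      q.2 • EuclideanSpace.single (2 : Fin 3) (1 : ℝ) := by
  ext i
  fin_cases i <;> simp [meridianPoint]

/-- The meridian embedding is differentiable with derivative `(h₁, h₂) ↦ h₁ e₀ + h₂ e₂`.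
[folklore] -/
theorem hasFDerivAt_meridianPoint (q : ℝ × ℝ) :
    HasFDerivAt meridianPoint
      ((ContinuousLinearMap.fst ℝ ℝ ℝ).smulRight (EuclideanSpace.single (0 : Fin 3) (1 : ℝ)) +
        (ContinuousLinearMap.snd ℝ ℝ ℝ).smulRight
          (EuclideanSpace.single (2 : Fin 3) (1 : ℝ))) q := by
  have h : meridianPoint = fun q : ℝ × ℝ => q.1 • EuclideanSpace.single (0 : Fin 3) (1 : ℝ) +
      q.2 • EuclideanSpace.single (2 : Fin 3) (1 : ℝ) := funext meridianPoint_eq_smul_add_smul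
  rw [h]
  exact ((hasFDerivAt_fst (𝕜 := ℝ) (p := q)).smul_const _).add
    ((hasFDerivAt_snd (𝕜 := ℝ) (p := q)).smul_const _)

/-- The derivative of the meridian embedding has operator norm at most `2`
(`‖h₁ e₀ + h₂ e₂‖ ≤ |h₁| + |h₂| ≤ 2 ‖(h₁, h₂)‖`). [folklore] -/
theorem norm_fderiv_meridianPoint_le (q : ℝ × ℝ) : ‖fderiv ℝ meridianPoint q‖ ≤ 2 := by
  rw [(hasFDerivAt_meridianPoint q).fderiv]
  refine ContinuousLinearMap.opNorm_le_bound _ (by norm_num) fun h => ?_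
  simp only [add_apply, ContinuousLinearMap.smulRight_apply,
    ContinuousLinearMap.coe_fst', ContinuousLinearMap.coe_snd']
  refine (norm_add_le _ _).trans ?_
  rw [norm_smul, norm_smul, EuclideanSpace.single, EuclideanSpace.single, PiLp.norm_single,
    PiLp.norm_single, norm_one, mul_one, mul_one]
  linarith [norm_fst_le h, norm_snd_le h]

/-- **Chain rule bound for the meridian profile**: `‖D(f ∘ meridianPoint)(q)‖ ≤ 2 ‖Df(meridianPoint q)‖`.
[folklore] -/
theorem norm_fderiv_comp_meridianPoint_le {f : EuclideanSpace ℝ (Fin 3) → ℝ}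
    (hf : Differentiable ℝ f) (q : ℝ × ℝ) :
    ‖fderiv ℝ (f ∘ meridianPoint) q‖ ≤ 2 * ‖fderiv ℝ f (meridianPoint q)‖ := by
  rw [fderiv_comp q (hf _) (hasFDerivAt_meridianPoint q).differentiableAt]
  refine (ContinuousLinearMap.opNorm_comp_le _ _).trans ?_
  rw [mul_comm]
  exact mul_le_mul_of_nonneg_right (norm_fderiv_meridianPoint_le q) (norm_nonneg _)

/-- Coordinates are controlled by the meridian point: `|ϱ| ≤ ‖(ϱ, 0, z)‖`, `|z| ≤ ‖(ϱ, 0, z)‖`.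
[folklore] -/
theorem abs_le_norm_meridianPoint (q : ℝ × ℝ) :
    |q.1| ≤ ‖meridianPoint q‖ ∧ |q.2| ≤ ‖meridianPoint q‖ := by
  constructor
  · have h := PiLp.norm_apply_le (meridianPoint q) 0
    simpa [meridianPoint] using h
  · have h := PiLp.norm_apply_le (meridianPoint q) 2
    simpa [meridianPoint] using h

/-- The meridian profile of a compactly supported function is compactly supported. [folklore] -/
theorem hasCompactSupport_comp_meridianPoint {β : Type*} [Zero β]
    {X : EuclideanSpace ℝ (Fin 3) → β}
    (hX : HasCompactSupport X) : HasCompactSupport (X ∘ meridianPoint) := by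
  obtain ⟨R, hR⟩ := (hX.isCompact.isBounded).subset_closedBall (0 : EuclideanSpace ℝ (Fin 3))
  refine HasCompactSupport.intro (K := Icc (-R) R ×ˢ Icc (-R) R)
    (isCompact_Icc.prod isCompact_Icc) fun q hq => ?_
  by_contra hne
  have hmem : meridianPoint q ∈ closedBall (0 : EuclideanSpace ℝ (Fin 3)) R :=
    hR (subset_tsupport _ hne)
  rw [mem_closedBall, dist_zero_right] at hmem
  obtain ⟨h1, h2⟩ := abs_le_norm_meridianPoint q
  exact hq ⟨abs_le.1 (h1.trans hmem), abs_le.1 (h2.trans hmem)⟩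

/-! ### Axisymmetric scalars: evenness of the profile and symmetry of `‖Df‖` -/

/-- `(−ϱ, 0, z) = R_π (ϱ, 0, z)`. [folklore] -/
theorem meridianPoint_neg (ρ z : ℝ) :
    meridianPoint (-ρ, z) = rotZ Real.pi (meridianPoint (ρ, z)) := by
  ext i
  fin_cases i <;> simp [meridianPoint, Real.cos_pi, Real.sin_pi]

/-- The meridian profile of an axisymmetric scalar is even in `ϱ`. [folklore] -/
theorem IsAxisymmetricScalar.comp_meridianPoint_neg {α : Sort*}
    {X : EuclideanSpace ℝ (Fin 3) → α}
    (hX : IsAxisymmetricScalar X) (ρ z : ℝ) :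
    X (meridianPoint (-ρ, z)) = X (meridianPoint (ρ, z)) := by
  rw [meridianPoint_neg, hX]

/-- The meridian profile of an axisymmetric scalar is a function of `|ϱ|`. [folklore] -/
theorem IsAxisymmetricScalar.comp_meridianPoint_abs {α : Sort*}
    {X : EuclideanSpace ℝ (Fin 3) → α}
    (hX : IsAxisymmetricScalar X) (ρ z : ℝ) :
    X (meridianPoint (|ρ|, z)) = X (meridianPoint (ρ, z)) := by
  rcases le_or_gt 0 ρ with h | h
  · rw [abs_of_nonneg h]
  · rw [abs_of_neg h, hX.comp_meridianPoint_neg]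

/-- **The derivative of an axisymmetric scalar has axisymmetric norm**: `‖Df(R_θ x)‖ = ‖Df(x)‖`
(`f ∘ R_θ = f` gives `Df(R_θ x) ∘ R_θ = Df(x)`, and `R_θ` is a linear isometry). [folklore] -/
theorem IsAxisymmetricScalar.norm_fderiv {f : EuclideanSpace ℝ (Fin 3) → ℝ}
    (hf : IsAxisymmetricScalar f)
    (hd : Differentiable ℝ f) : IsAxisymmetricScalar fun x => ‖fderiv ℝ f x‖ := by
  intro θ x
  have hcomp : (fun y => f (rotZLIE θ y)) = f := funext fun y => hf θ y
  have hl : HasFDerivAt (fun y => f (rotZLIE θ y))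
      ((fderiv ℝ f (rotZ θ x)).comp
        (rotZLIE θ : EuclideanSpace ℝ (Fin 3) →L[ℝ] EuclideanSpace ℝ (Fin 3))) x :=
    (hd (rotZLIE θ x)).hasFDerivAt.comp x (rotZLIE θ).toContinuousLinearEquiv.hasFDerivAt
  rw [hcomp] at hl
  show ‖fderiv ℝ f (rotZ θ x)‖ = ‖fderiv ℝ f x‖
  rw [hl.fderiv]
  exact ((fderiv ℝ f (rotZ θ x)).opNorm_comp_linearIsometryEquiv (rotZLIE θ)).symm

/-! ### The weight `ϱ⁻¹` and the radial reduction -/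

/-- **Radial reduction against the weight `ϱ⁻¹`**: for an axisymmetric scalar `X` on `ℝ³` with
`X ϱ⁻¹` integrable and integrable meridian profile,
`∫ X ϱ⁻¹ dx = (c₂/2) ∫_{ℝ×ℝ} X(ϱ, 0, z) d(ϱ, z)` (`dx = ϱ dϱ dφ dz`, the profile being even in
`ϱ`; `c₂ = 2π` is the accepted `radialConst₂`). [folklore] -/
theorem IsAxisymmetricScalar.integral_mul_inv_cylRadius_eq {X : EuclideanSpace ℝ (Fin 3) → ℝ}
    (hX : IsAxisymmetricScalar X)
    (hi : Integrable fun x => X x * (cylRadius x)⁻¹)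
    (hp : Integrable (fun q : ℝ × ℝ => X (meridianPoint q))) :
    ∫ x, X x * (cylRadius x)⁻¹ = radialConst₂ / 2 * ∫ q : ℝ × ℝ, X (meridianPoint q) := by
  have hax : IsAxisymmetricScalar fun x => X x * (cylRadius x)⁻¹ := fun θ x => by
    simp only [hX θ x, cylRadius_rotZ]
  rw [hax.integral_eq hi]
  -- the slices: `∫₀^∞ ϱ X(ϱ,0,z) ϱ⁻¹ dϱ = ∫₀^∞ X(ϱ,0,z) dϱ = ½ ∫_ℝ X(ϱ,0,z) dϱ`
  have hslice : ∀ z : ℝ, (∫ ρ in Ioi (0 : ℝ), ρ • (X (meridianPoint (ρ, z)) *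
      (cylRadius (meridianPoint (ρ, z)))⁻¹)) = 1 / 2 * ∫ ρ, X (meridianPoint (ρ, z)) := by
    intro z
    have h1 : (∫ ρ in Ioi (0 : ℝ), ρ • (X (meridianPoint (ρ, z)) *
        (cylRadius (meridianPoint (ρ, z)))⁻¹)) = ∫ ρ in Ioi (0 : ℝ), X (meridianPoint (ρ, z)) := by
      refine setIntegral_congr_fun measurableSet_Ioi fun ρ hρ => ?_
      have hρ' : (0 : ℝ) < ρ := hρ
      simp only [cylRadius_meridianPoint_eq_abs, abs_of_pos hρ', smul_eq_mul]
      field_simp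
    have h2 : ∫ ρ, X (meridianPoint (ρ, z)) = 2 * ∫ ρ in Ioi (0 : ℝ), X (meridianPoint (ρ, z)) := by
      rw [← integral_comp_abs]
      exact integral_congr_ae (Eventually.of_forall fun ρ => (hX.comp_meridianPoint_abs ρ z).symm)
    rw [h1, h2]
    ring
  simp_rw [hslice, smul_eq_mul]
  rw [integral_const_mul, integral_const_mul, ← mul_assoc]
  congr 1
  · ring
  · rw [Measure.volume_eq_prod, integral_prod_symm _ (by simpa [Measure.volume_eq_prod] using hp)]

/-- A function vanishing where `ϱ < ϱ₀` (`ϱ₀ > 0`) is dominated against the weight: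
`|X ϱ⁻¹| ≤ ϱ₀⁻¹ |X|`; in particular `X ϱ⁻¹` is integrable when `X` is. [folklore] -/
theorem integrable_mul_inv_cylRadius {X : EuclideanSpace ℝ (Fin 3) → ℝ} {ρ₀ : ℝ}
    (h0 : 0 < ρ₀)
    (hX : Integrable X) (hsupp : ∀ x, X x ≠ 0 → ρ₀ ≤ cylRadius x) :
    Integrable fun x => X x * (cylRadius x)⁻¹ := by
  refine Integrable.mono' (hX.norm.const_mul ρ₀⁻¹)
    (hX.aestronglyMeasurable.mul
      (continuous_cylRadius.measurable.inv.aestronglyMeasurable)) (Eventually.of_forall fun x => ?_)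
  by_cases hx : X x = 0
  · simp [hx]
  · have hr : ρ₀ ≤ cylRadius x := hsupp x hx
    have hr0 : 0 < cylRadius x := h0.trans_le hr
    rw [norm_mul, norm_inv, Real.norm_eq_abs, Real.norm_eq_abs, abs_of_pos hr0, mul_comm]
    exact mul_le_mul_of_nonneg_right ((inv_le_inv₀ hr0 h0).2 hr) (abs_nonneg _)

/-- Lower comparison on `{ϱ₀ ≤ ϱ}`: `ϱ₀ ∫ X ϱ⁻¹ ≤ ∫ X` for `X ≥ 0` vanishing where `ϱ < ϱ₀`.
[folklore] -/
theorem mul_integral_mul_inv_cylRadius_le {X : EuclideanSpace ℝ (Fin 3) → ℝ} {ρ₀ : ℝ}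
    (h0 : 0 < ρ₀)
    (hX : Integrable X) (hX0 : ∀ x, 0 ≤ X x) (hsupp : ∀ x, X x ≠ 0 → ρ₀ ≤ cylRadius x) :
    ρ₀ * ∫ x, X x * (cylRadius x)⁻¹ ≤ ∫ x, X x := by
  rw [← integral_const_mul]
  refine integral_mono ((integrable_mul_inv_cylRadius h0 hX hsupp).const_mul ρ₀) hX fun x => ?_
  dsimp only
  by_cases hx : X x = 0
  · simp [hx]
  · have hr : ρ₀ ≤ cylRadius x := hsupp x hx
    have hr0 : 0 < cylRadius x := h0.trans_le hr
    have h1 : ρ₀ / cylRadius x ≤ 1 := by rw [div_le_one hr0]; exact hr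
    calc ρ₀ * (X x * (cylRadius x)⁻¹) = X x * (ρ₀ / cylRadius x) := by ring
      _ ≤ X x * 1 := mul_le_mul_of_nonneg_left h1 (hX0 x)
      _ = X x := mul_one _

/-- Upper comparison on `{ϱ ≤ ϱ₁}`: `∫ X ≤ ϱ₁ ∫ X ϱ⁻¹` for `X ≥ 0` vanishing where `ϱ < ϱ₀` or
`ϱ₁ < ϱ` (`0 < ϱ₀`). [folklore] -/
theorem integral_le_mul_integral_mul_inv_cylRadius {X : EuclideanSpace ℝ (Fin 3) → ℝ} {ρ₀ ρ₁ : ℝ}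
    (h0 : 0 < ρ₀)
    (hX : Integrable X) (hX0 : ∀ x, 0 ≤ X x)
    (hsupp : ∀ x, X x ≠ 0 → ρ₀ ≤ cylRadius x ∧ cylRadius x ≤ ρ₁) :
    ∫ x, X x ≤ ρ₁ * ∫ x, X x * (cylRadius x)⁻¹ := by
  rw [← integral_const_mul]
  refine integral_mono hX
    ((integrable_mul_inv_cylRadius h0 hX fun x hx => (hsupp x hx).1).const_mul ρ₁) fun x => ?_
  dsimp only
  by_cases hx : X x = 0
  · simp [hx]
  · obtain ⟨hr, hr1⟩ := hsupp x hx
    have hr0 : 0 < cylRadius x := h0.trans_le hr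
    have h1 : cylRadius x / cylRadius x ≤ ρ₁ / cylRadius x :=
      div_le_div_of_nonneg_right hr1 hr0.le
    calc X x = X x * (cylRadius x / cylRadius x) := by rw [div_self hr0.ne', mul_one]
      _ ≤ X x * (ρ₁ / cylRadius x) := mul_le_mul_of_nonneg_left h1 (hX0 x)
      _ = ρ₁ * (X x * (cylRadius x)⁻¹) := by ring

/-! ### The inequality -/

/-- `∫⁻ ofReal` of a nonnegative integrable function is `ofReal ∫`. [folklore] -/
theorem lintegral_ofReal_eq_ofReal_integral {α : Type*} [MeasurableSpace α] {μ : Measure α}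
    {F : α → ℝ} (hF : Integrable F μ) (hF0 : ∀ a, 0 ≤ F a) :
    ∫⁻ a, ENNReal.ofReal (F a) ∂μ = ENNReal.ofReal (∫ a, F a ∂μ) :=
  (ofReal_integral_eq_lintegral_ofReal hF (Eventually.of_forall hF0)).symm

/-- **The planar Ladyzhenskaya inequality in real form** on `ℝ × ℝ`: for a compactly supported
`C¹` function `g`, `∫ g⁴ ≤ 4 C_GNS (∫ g²) (∫ ‖Dg‖²)`, `C_GNS` Mathlib's Gagliardo–Nirenberg–Sobolev
constant `lintegralPowLePowLIntegralFDerivConst volume 2` (the accepted `ℝ≥0∞`-valued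
`FunctionSpaces.lintegral_enorm_pow_four_le`, Ladyzhenskaya 1959, rewritten for Bochner integrals
of continuous compactly supported integrands). [folklore] -/
theorem integral_pow_four_le_planar {g : ℝ × ℝ → ℝ} (hg : ContDiff ℝ 1 g)
    (hgc : HasCompactSupport g) :
    ∫ q, g q ^ 4 ≤ 4 * (lintegralPowLePowLIntegralFDerivConst (volume : Measure (ℝ × ℝ)) 2 : ℝ) *
      (∫ q, g q ^ 2) * ∫ q, ‖fderiv ℝ g q‖ ^ 2 := by
  haveI : (volume : Measure (ℝ × ℝ)).IsAddHaarMeasure := by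
    rw [Measure.volume_eq_prod]
    infer_instance
  have hgcont : Continuous g := hg.continuous
  have hDgcont : Continuous fun q => fderiv ℝ g q := hg.continuous_fderiv one_ne_zero
  have hgc4 : HasCompactSupport fun q => g q ^ 4 :=
    hgc.comp_left (g := fun v : ℝ => v ^ 4) (by simp)
  have hgc2 : HasCompactSupport fun q => g q ^ 2 :=
    hgc.comp_left (g := fun v : ℝ => v ^ 2) (by simp)
  have hgcD : HasCompactSupport fun q => ‖fderiv ℝ g q‖ ^ 2 :=
    (hgc.fderiv ℝ).comp_left (g := fun A : ℝ × ℝ →L[ℝ] ℝ => ‖A‖ ^ 2) (by simp)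
  have h4i : Integrable fun q => g q ^ 4 := (hgcont.pow 4).integrable_of_hasCompactSupport hgc4
  have h2i : Integrable fun q => g q ^ 2 := (hgcont.pow 2).integrable_of_hasCompactSupport hgc2
  have hDi : Integrable fun q => ‖fderiv ℝ g q‖ ^ 2 :=
    (hDgcont.norm.pow 2).integrable_of_hasCompactSupport hgcD
  have hE : Module.finrank ℝ (ℝ × ℝ) = 2 := by
    rw [Module.finrank_prod, Module.finrank_self]
  have hplanar := FunctionSpaces.lintegral_enorm_pow_four_le (volume : Measure (ℝ × ℝ)) hE hg hgc
  have e4 : ∫⁻ q, ‖g q‖ₑ ^ 4 = ENNReal.ofReal (∫ q, g q ^ 4) := by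
    rw [← lintegral_ofReal_eq_ofReal_integral h4i fun q => by positivity]
    refine lintegral_congr fun q => ?_
    rw [Real.enorm_eq_ofReal_abs, ← ENNReal.ofReal_pow (abs_nonneg _)]
    congr 1
    calc |g q| ^ 4 = (|g q| ^ 2) ^ 2 := by ring
      _ = g q ^ 4 := by rw [sq_abs]; ring
  have e2 : ∫⁻ q, ‖g q‖ₑ ^ 2 = ENNReal.ofReal (∫ q, g q ^ 2) := by
    rw [← lintegral_ofReal_eq_ofReal_integral h2i fun q => by positivity]
    refine lintegral_congr fun q => ?_
    rw [Real.enorm_eq_ofReal_abs, ← ENNReal.ofReal_pow (abs_nonneg _), sq_abs]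
  have eD : ∫⁻ q, ‖fderiv ℝ g q‖ₑ ^ 2 = ENNReal.ofReal (∫ q, ‖fderiv ℝ g q‖ ^ 2) := by
    rw [← lintegral_ofReal_eq_ofReal_integral hDi fun q => by positivity]
    refine lintegral_congr fun q => ?_
    rw [← ofReal_norm, ← ENNReal.ofReal_pow (norm_nonneg _)]
  have hI2 : 0 ≤ ∫ q, g q ^ 2 := integral_nonneg fun q => by positivity
  have hID : 0 ≤ ∫ q, ‖fderiv ℝ g q‖ ^ 2 := integral_nonneg fun q => by positivity
  rw [e4, e2, eD, ← ENNReal.ofReal_coe_nnreal, ← ENNReal.ofReal_ofNat,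
    ← ENNReal.ofReal_mul (by norm_num), ← ENNReal.ofReal_mul hI2,
    ← ENNReal.ofReal_mul (by positivity)] at hplanar
  have h := (ENNReal.ofReal_le_ofReal_iff (by positivity)).1 hplanar
  linarith [h]

/-- **Ladyzhenskaya's inequality for axially symmetric functions supported off the axis**
(Seregin–Zajaczkowski 2007, proof of Lemma 4.2, displays before (4.10) and (4.12):
"by Ladyzhenskaya's inequality, `∫_𝒞̃ |·|⁴ dx ≤ c ∫∫ |·|⁴ dϱ dx₃ ≤ c ∫∫ |·|² dϱ dx₃ ∫∫ |∇_a ·|² dϱ dx₃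
≤ c ∫_𝒞̃ |·|² dx ∫_𝒞̃ |∇ ·|² dx`", on the shell `𝒞̃ = {1/4 < |x'| < 3, |x₃| < 2}`). For
`0 < ϱ₀ ≤ ϱ₁` there is a constant `C ≥ 0` such that every `C¹` compactly supported axially
symmetric scalar `f : ℝ³ → ℝ` vanishing outside `{ϱ₀ ≤ |x'| ≤ ϱ₁}` satisfies
`∫ f⁴ dx ≤ C (∫ f² dx) (∫ ‖Df‖² dx)`. Proof: module docstring (planar Ladyzhenskaya for the
meridian profile, accepted `FunctionSpaces.lintegral_enorm_pow_four_le`, and `dx = ϱ dϱ dφ dz` with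
`ϱ₀ ≤ ϱ ≤ ϱ₁`). [cite: SereginZajaczkowski2007, proof of Lemma 4.2, displays before (4.10) and (4.12)] -/
theorem exists_axisym_ladyzhenskaya_const {ρ₀ ρ₁ : ℝ} (h0 : 0 < ρ₀) (h01 : ρ₀ ≤ ρ₁) :
    ∃ C : ℝ, 0 ≤ C ∧ ∀ f : EuclideanSpace ℝ (Fin 3) → ℝ, ContDiff ℝ 1 f → HasCompactSupport f →
      IsAxisymmetricScalar f → (∀ x, f x ≠ 0 → ρ₀ ≤ cylRadius x ∧ cylRadius x ≤ ρ₁) →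
        ∫ x, f x ^ 4 ≤ C * (∫ x, f x ^ 2) * ∫ x, ‖fderiv ℝ f x‖ ^ 2 := by
  -- the planar constant
  set K : ℝ := 4 * (lintegralPowLePowLIntegralFDerivConst (volume : Measure (ℝ × ℝ)) 2 : ℝ) with hK
  have hK0 : 0 ≤ K := by positivity
  have hc2 : 0 < radialConst₂ := radialConst₂_pos
  have hρ₁ : 0 ≤ ρ₁ := h0.le.trans h01
  refine ⟨ρ₁ * (radialConst₂ / 2) * K * (2 / (radialConst₂ * ρ₀)) * (8 / (radialConst₂ * ρ₀)),
    by positivity, ?_⟩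
  intro f hf hfc hfa hsupp
  have hfd : Differentiable ℝ f := hf.differentiable one_ne_zero
  have hfcont : Continuous f := hf.continuous
  have hDcont : Continuous fun x => fderiv ℝ f x := hf.continuous_fderiv one_ne_zero
  have hDc : HasCompactSupport fun x => fderiv ℝ f x := hfc.fderiv ℝ
  -- support of `Df`
  have hclosed : IsClosed {x : EuclideanSpace ℝ (Fin 3) | ρ₀ ≤ cylRadius x ∧ cylRadius x ≤ ρ₁} := by
    have : {x : EuclideanSpace ℝ (Fin 3) | ρ₀ ≤ cylRadius x ∧ cylRadius x ≤ ρ₁} =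
        cylRadius ⁻¹' Icc ρ₀ ρ₁ := rfl
    rw [this]
    exact isClosed_Icc.preimage continuous_cylRadius
  have htsupp : tsupport f ⊆ {x : EuclideanSpace ℝ (Fin 3) | ρ₀ ≤ cylRadius x ∧ cylRadius x ≤ ρ₁} :=
    closure_minimal (fun x hx => hsupp x hx) hclosed
  have hsuppD : ∀ x, fderiv ℝ f x ≠ 0 → ρ₀ ≤ cylRadius x ∧ cylRadius x ≤ ρ₁ := fun x hx =>
    htsupp (tsupport_fderiv_subset ℝ (subset_tsupport _ hx))
  -- the three integrands on `ℝ³`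
  set X4 : EuclideanSpace ℝ (Fin 3) → ℝ := fun x => f x ^ 4 with hX4
  set X2 : EuclideanSpace ℝ (Fin 3) → ℝ := fun x => f x ^ 2 with hX2
  set XD : EuclideanSpace ℝ (Fin 3) → ℝ := fun x => ‖fderiv ℝ f x‖ ^ 2 with hXD
  have hX4a : IsAxisymmetricScalar X4 := fun θ x => by simp only [hX4, hfa θ x]
  have hX2a : IsAxisymmetricScalar X2 := fun θ x => by simp only [hX2, hfa θ x]
  have hXDa : IsAxisymmetricScalar XD := fun θ x => by
    simp only [hXD, hfa.norm_fderiv hfd θ x]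
  have hX4c : HasCompactSupport X4 := hfc.comp_left (g := fun v : ℝ => v ^ 4) (by simp)
  have hX2c : HasCompactSupport X2 := hfc.comp_left (g := fun v : ℝ => v ^ 2) (by simp)
  have hXDc : HasCompactSupport XD :=
    hDc.comp_left (g := fun A : EuclideanSpace ℝ (Fin 3) →L[ℝ] ℝ => ‖A‖ ^ 2) (by simp)
  have hX4m : Continuous X4 := hfcont.pow 4
  have hX2m : Continuous X2 := hfcont.pow 2
  have hXDm : Continuous XD := hDcont.norm.pow 2
  have hX4i : Integrable X4 := hX4m.integrable_of_hasCompactSupport hX4c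
  have hX2i : Integrable X2 := hX2m.integrable_of_hasCompactSupport hX2c
  have hXDi : Integrable XD := hXDm.integrable_of_hasCompactSupport hXDc
  have hX4s : ∀ x, X4 x ≠ 0 → ρ₀ ≤ cylRadius x ∧ cylRadius x ≤ ρ₁ := fun x hx =>
    hsupp x fun h => hx (by simp [hX4, h])
  have hX2s : ∀ x, X2 x ≠ 0 → ρ₀ ≤ cylRadius x := fun x hx =>
    (hsupp x fun h => hx (by simp [hX2, h])).1
  have hXDs : ∀ x, XD x ≠ 0 → ρ₀ ≤ cylRadius x := fun x hx =>
    (hsuppD x fun h => hx (by simp [hXD, h])).1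
  -- the meridian profile and its integrands on `ℝ × ℝ`
  set g : ℝ × ℝ → ℝ := f ∘ meridianPoint with hg
  have hg1 : ContDiff ℝ 1 g := ContDiff.comp_meridianPoint hf
  have hgc : HasCompactSupport g := hasCompactSupport_comp_meridianPoint hfc
  have hgcont : Continuous g := hg1.continuous
  have hDgcont : Continuous fun q => fderiv ℝ g q := hg1.continuous_fderiv one_ne_zero
  have hmPc : Continuous meridianPoint := (contDiff_meridianPoint (n := 1)).continuous
  have hP4c : HasCompactSupport fun q : ℝ × ℝ => X4 (meridianPoint q) :=
    hasCompactSupport_comp_meridianPoint (X := X4) hX4c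
  have hP2c : HasCompactSupport fun q : ℝ × ℝ => X2 (meridianPoint q) :=
    hasCompactSupport_comp_meridianPoint (X := X2) hX2c
  have hPDc : HasCompactSupport fun q : ℝ × ℝ => XD (meridianPoint q) :=
    hasCompactSupport_comp_meridianPoint (X := XD) hXDc
  have hDgc : HasCompactSupport fun q : ℝ × ℝ => ‖fderiv ℝ g q‖ ^ 2 :=
    (hgc.fderiv ℝ).comp_left (g := fun A : ℝ × ℝ →L[ℝ] ℝ => ‖A‖ ^ 2) (by simp)
  have hP4i : Integrable fun q : ℝ × ℝ => X4 (meridianPoint q) :=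
    (Continuous.comp (g := X4) hX4m hmPc).integrable_of_hasCompactSupport hP4c
  have hP2i : Integrable fun q : ℝ × ℝ => X2 (meridianPoint q) :=
    (Continuous.comp (g := X2) hX2m hmPc).integrable_of_hasCompactSupport hP2c
  have hPDi : Integrable fun q : ℝ × ℝ => XD (meridianPoint q) :=
    (Continuous.comp (g := XD) hXDm hmPc).integrable_of_hasCompactSupport hPDc
  have hDg2i : Integrable fun q : ℝ × ℝ => ‖fderiv ℝ g q‖ ^ 2 :=
    (hDgcont.norm.pow 2).integrable_of_hasCompactSupport hDgc
  -- (1) the planar Ladyzhenskaya inequality for `g`, in real form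
  have hreal : ∫ q : ℝ × ℝ, X4 (meridianPoint q) ≤
      K * (∫ q : ℝ × ℝ, X2 (meridianPoint q)) * ∫ q : ℝ × ℝ, ‖fderiv ℝ g q‖ ^ 2 :=
    integral_pow_four_le_planar hg1 hgc
  -- (2) `∫ ‖Dg‖² ≤ 4 ∫ ‖Df ∘ meridianPoint‖²`
  have hDg : ∫ q : ℝ × ℝ, ‖fderiv ℝ g q‖ ^ 2 ≤ 4 * ∫ q : ℝ × ℝ, XD (meridianPoint q) := by
    rw [← integral_const_mul]
    refine integral_mono hDg2i (hPDi.const_mul 4) fun q => ?_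
    dsimp only [hXD]
    have h := norm_fderiv_comp_meridianPoint_le hfd q
    have h0 : 0 ≤ ‖fderiv ℝ (f ∘ meridianPoint) q‖ := norm_nonneg _
    nlinarith [h, h0]
  -- (3) the radial reductions
  have r4 := hX4a.integral_mul_inv_cylRadius_eq (integrable_mul_inv_cylRadius h0 hX4i
    fun x hx => (hX4s x hx).1) hP4i
  have r2 := hX2a.integral_mul_inv_cylRadius_eq (integrable_mul_inv_cylRadius h0 hX2i hX2s) hP2i
  have rD := hXDa.integral_mul_inv_cylRadius_eq (integrable_mul_inv_cylRadius h0 hXDi hXDs) hPDi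
  -- (4) the comparisons with the weight
  have c4 : ∫ x, X4 x ≤ ρ₁ * ∫ x, X4 x * (cylRadius x)⁻¹ :=
    integral_le_mul_integral_mul_inv_cylRadius h0 hX4i (fun x => by positivity) hX4s
  have c2 : ρ₀ * ∫ x, X2 x * (cylRadius x)⁻¹ ≤ ∫ x, X2 x :=
    mul_integral_mul_inv_cylRadius_le h0 hX2i (fun x => by positivity) hX2s
  have cD : ρ₀ * ∫ x, XD x * (cylRadius x)⁻¹ ≤ ∫ x, XD x :=
    mul_integral_mul_inv_cylRadius_le h0 hXDi (fun x => by positivity) hXDs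
  -- (5) assembling
  have hP2 : ∫ q : ℝ × ℝ, X2 (meridianPoint q) ≤ 2 / (radialConst₂ * ρ₀) * ∫ x, X2 x := by
    rw [r2] at c2
    have : ∫ q : ℝ × ℝ, X2 (meridianPoint q) =
        2 / (radialConst₂ * ρ₀) * (ρ₀ * (radialConst₂ / 2 * ∫ q : ℝ × ℝ, X2 (meridianPoint q))) := by
      field_simp
    rw [this]
    exact mul_le_mul_of_nonneg_left c2 (by positivity)
  have hPD : ∫ q : ℝ × ℝ, ‖fderiv ℝ g q‖ ^ 2 ≤ 8 / (radialConst₂ * ρ₀) * ∫ x, XD x := by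
    rw [rD] at cD
    refine hDg.trans ?_
    have : 4 * ∫ q : ℝ × ℝ, XD (meridianPoint q) =
        8 / (radialConst₂ * ρ₀) * (ρ₀ * (radialConst₂ / 2 * ∫ q : ℝ × ℝ, XD (meridianPoint q))) := by
      field_simp
      ring
    rw [this]
    exact mul_le_mul_of_nonneg_left cD (by positivity)
  have hI2 : 0 ≤ ∫ x, X2 x := integral_nonneg fun x => by positivity
  have hP2' : 0 ≤ ∫ q : ℝ × ℝ, X2 (meridianPoint q) := integral_nonneg fun q => by positivity
  calc ∫ x, f x ^ 4 = ∫ x, X4 x := rfl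
    _ ≤ ρ₁ * ∫ x, X4 x * (cylRadius x)⁻¹ := c4
    _ = ρ₁ * (radialConst₂ / 2) * ∫ q : ℝ × ℝ, X4 (meridianPoint q) := by rw [r4]; ring
    _ ≤ ρ₁ * (radialConst₂ / 2) *
        (K * (∫ q : ℝ × ℝ, X2 (meridianPoint q)) * ∫ q : ℝ × ℝ, ‖fderiv ℝ g q‖ ^ 2) := by
        gcongr
    _ ≤ ρ₁ * (radialConst₂ / 2) *
        (K * (2 / (radialConst₂ * ρ₀) * ∫ x, X2 x) * (8 / (radialConst₂ * ρ₀) * ∫ x, XD x)) := by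
        gcongr
    _ = ρ₁ * (radialConst₂ / 2) * K * (2 / (radialConst₂ * ρ₀)) * (8 / (radialConst₂ * ρ₀)) *
        (∫ x, f x ^ 2) * ∫ x, ‖fderiv ℝ f x‖ ^ 2 := by
        simp only [hX2, hXD]
        ring

end Literature.Analysis.FluidPDE
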